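import Literature.NumberTheory.GaloisCohomology.Howard2004.CofinalEmbeddingColimitProofs
import HarnessLib

/-!
# Howard 2004, §1.6: the propagated conditions `condA` agree along a cofinal embedding of towers —
# `H¹_F(K, A) ≃ H¹_{F'}(K, A')` from the embedding letters alone (theorems only)

Topic `NumberTheory/GaloisCohomology/Howard2004` (sequel to `CofinalEmbeddingColimitProofs` (C2: `Ψ : H¹(K, A) ≃
H¹(K, A')` and `Ψ(H¹_F(K, A)) = H¹_{F'}(K, A')` GIVEN the identification `hιA` of the propagated conditions
`condA` at the marked levels) and `SelmerARepresentativeProofs` (`condA F j v = ⋃_d incLocIter⁻¹(F_{j+d,v})`,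
`incLocIter_succ_heq`, `heq_incLoc`, `mem_iff_of_heq`)).  THEOREMS ONLY: no definition, no named fact, no instance,
no notation, no `sorry`.

WHY (INPUTS row G87 = `Howard2004.thm161_dvrKolyvaginBound` = Howard Thm. 1.6.1; stub `stub_h161` of the μ-crux
stmt-BirchSwinnertonDyer-22642; cell `pub/bsd-print-x9`, seat `bsd-line-x10b-p1-w7` g8, brick (COFINAL) of
`bsd-line-x10b-p1` LEAD g11's note `HOME/p1/COFINAL-SPEC-x10b-p1-g11.md`, which lists «condA-compatibility (the
delicate one)» among the things the refinement constructor would have to deliver).  On `DVRSetting`s with H.0–H.5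
`condA F = F` (`DVRSetting.condA_eq`, Lemma 1.3.3) and the wrapper `ConclusionCofinalTransferProofs` uses that; this
file PROVES the condA-compatibility at the tower level from the embedding letters alone — the level conditions agree
at the marked levels along `ι_k` (`hιF`), `cond_red`/`cond_smul` on both towers, `ι ∘ red = red' ∘ ι`, `e' ∘ σ = e`,
`π' = π`, cofinality — with NO cartesian hypothesis, so that C2 applies to any pair of towers (e.g. the `Λ`-adic
`CoeffTowerSetting`s).  Howard: `A = T ⊗ 𝒟` with `F ⊗ Φ` propagated to `A` (arXiv:1202.6340 p. 11 L18–20) does not see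
the choice of the cofinal system of finite levels.

* §1 (one tower) `heq_incLocIter`, **`incLocIter_add_heq`** (`incLocIter (j+D₁) D₂ ∘ incLocIter j D₁ ≍ incLocIter j
  (D₁+D₂)`), `incLocIter_mem_of_mem` / `incLocIter_mem_of_incLocIter_mem` (the iterates of `H¹(K_v, inc)` carry
  `F_{j,v}` into `F_{j+D,v}`, from `map_incLoc_le_of_cond_red_of_cond_smul`);
* §2 (embedding) **`cofinal_localCohomologyMap_incLoc`** (`H¹(K_v, ι_{k+1}) ∘ H¹(K_v, inc_k) = inc'^{d k} ∘ H¹(K_v, ι_k)`,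
  from the module-level transition `exists_linearMap_incH1LE_eq`), `cofinal_localCohomologyMap_incLocIter_heq` (all
  steps, heterogeneous: `σ k + D = σ (k+m)`), **`propagateStructure_condA_eq_of_cofinal`**
  (`(hιq k).propagateStructure (condA F k) = condA F' (σ k)`), and the packaged C2
  **`exists_addEquiv_H1A_map_selmerA_eq_of_cofinal`** (`∃ Ψ : H¹(K,A) ≃+ H¹(K,A')`, `Ψ [c]_k = [H¹(ι_k) c]_{σ k}`,
  `Ψ(H¹_F(K,A)) = H¹_{F'}(K,A')`) from `hιF` only.

HONEST FRAMING: tower bookkeeping; `thm161_dvrKolyvaginBound` is NOT proved; no summit statement is proved; the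
Birch–Swinnerton-Dyer conjecture is not proved by any of this.
References: [Howard2004HeegnerKolyvagin] B. Howard, Compositio Math. 140 (2004), Def. 1.1.1, Def. 1.1.3, §1.6 / Thm.
1.6.1 (arXiv:1202.6340 p. 5 L20–45 and L93–99, p. 11 L18–28, p. 12 L29–48); [SerreGaloisCohomology1997] I §2.2, §2.4.
-/

set_option autoImplicit false

noncomputable section

open Function NumberField IsDedekindDomain Field
open scoped NumberField ContRepresentation

namespace Literature.NumberTheory.GaloisCohomology.Howard2004

open Literature.NumberTheory.GaloisRepresentations
open Literature.NumberTheory.GaloisRepresentations.DiscreteGaloisModule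
open Literature.NumberTheory.GaloisRepresentations.galoisCohomology

namespace AdicTower

variable {K : Type} [Field K] [NumberField K] {R : Type} [CommRing R] [IsLocalRing R]
  {N : ℕ → Type} [∀ k, AddCommGroup (N k)] [∀ k, TopologicalSpace (N k)] [∀ k, DiscreteTopology (N k)]
  [∀ k, Module R (N k)]

/-! ## §1 Iterates of the local transition maps on ONE tower: index bookkeeping and `inc`-stability -/

section One

variable (T : AdicTower K R N) (π : R) (e : ℕ → ℕ)
  (hkill : ∀ k, ∀ r ∈ IsLocalRing.maximalIdeal R ^ e k, ∀ x : N k, r • x = 0)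
  (hker : ∀ k, LinearMap.ker (T.red k) = (IsLocalRing.maximalIdeal R ^ e k) • (⊤ : Submodule R (N (k + 1))))
  (hπ : π ∈ IsLocalRing.maximalIdeal R) (he : ∀ k, e k ≤ e (k + 1))

/-- Transport of `incLocIter` along an equality of starting levels (heterogeneous form).
[cite: Howard2004HeegnerKolyvagin, §1.6 (arXiv p. 11, L18–20)] -/
theorem heq_incLocIter (v : Place K) (D : ℕ) {n n' : ℕ} (h : n = n')
    {a : galoisCohomology ((T.ρ n).toLocal v) 1} {b : galoisCohomology ((T.ρ n').toLocal v) 1} (hab : HEq a b) :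
    HEq (incLocIter T π e hkill hker hπ he n v D a) (incLocIter T π e hkill hker hπ he n' v D b) := by
  subst h
  rw [eq_of_heq hab]

/-- **`incLocIter (j + D₁) D₂ ∘ incLocIter j D₁ ≍ incLocIter j (D₁ + D₂)`** (the levels `j + D₁ + D₂` and
`j + (D₁ + D₂)` agree only propositionally). [cite: Howard2004HeegnerKolyvagin, §1.6 (arXiv p. 11, L18–20)] -/
theorem incLocIter_add_heq (j : ℕ) (v : Place K) (D₁ : ℕ) :
    ∀ (D₂ : ℕ) (x : galoisCohomology ((T.ρ j).toLocal v) 1),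
      HEq (incLocIter T π e hkill hker hπ he (j + D₁) v D₂ (incLocIter T π e hkill hker hπ he j v D₁ x))
        (incLocIter T π e hkill hker hπ he j v (D₁ + D₂) x)
  | 0, _ => HEq.rfl
  | D₂ + 1, x =>
    heq_incLoc T π e hkill hker hπ he v (Nat.add_assoc j D₁ D₂) (incLocIter_add_heq j v D₁ D₂ x)

/-- **`H¹(K_v, inc)` iterated carries `F_{j,v}` into `F_{j+D,v}`** when `F_{k,v} = red(F_{k+1,v})` and the conditions
are `R`-stable. [cite: Howard2004HeegnerKolyvagin, Def. 1.1.1, Def. 1.1.3 and §1.6 (arXiv p. 5 L20–45, p. 11 L18–20)] -/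
theorem incLocIter_mem_of_mem (F : ∀ k, SelmerStructure (T.ρ k))
    (hred : ∀ (k : ℕ) (v : Place K), ((F (k + 1)) v).map
      (ContinuousRep.cohomologyMap ((T.ρ (k + 1)).toLocal v) ((T.ρ k).toLocal v)
        (T.red k).toAddMonoidHom continuous_of_discreteTopology
        (fun _ x => T.red_equivariant k _ x) 1) = F k v)
    (hsmul : ∀ (k : ℕ) (v : Place K) (r : R), (F k v).map
      (scalarMapH1 ((T.ρ k).toLocal v) ((T.hlin k).restrictField _) r) ≤ F k v)
    (j : ℕ) (v : Place K) {x : galoisCohomology ((T.ρ j).toLocal v) 1} (hx : x ∈ F j v) :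
    ∀ D : ℕ, incLocIter T π e hkill hker hπ he j v D x ∈ F (j + D) v
  | 0 => hx
  | D + 1 => map_incLoc_le_of_cond_red_of_cond_smul T π e hkill hker hπ he F hred hsmul (j + D) v
      ⟨_, incLocIter_mem_of_mem F hred hsmul j v hx D, rfl⟩

/-- Once an iterate of `x` lies in the level condition, all further iterates do (directed union, monotone).
[cite: Howard2004HeegnerKolyvagin, §1.6 (arXiv p. 11, L18–20)] -/
theorem incLocIter_mem_of_incLocIter_mem (F : ∀ k, SelmerStructure (T.ρ k))
    (hred : ∀ (k : ℕ) (v : Place K), ((F (k + 1)) v).map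
      (ContinuousRep.cohomologyMap ((T.ρ (k + 1)).toLocal v) ((T.ρ k).toLocal v)
        (T.red k).toAddMonoidHom continuous_of_discreteTopology
        (fun _ x => T.red_equivariant k _ x) 1) = F k v)
    (hsmul : ∀ (k : ℕ) (v : Place K) (r : R), (F k v).map
      (scalarMapH1 ((T.ρ k).toLocal v) ((T.hlin k).restrictField _) r) ≤ F k v)
    (j : ℕ) (v : Place K) (x : galoisCohomology ((T.ρ j).toLocal v) 1) {D D' : ℕ} (hDD' : D ≤ D')
    (hx : incLocIter T π e hkill hker hπ he j v D x ∈ F (j + D) v) :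
    incLocIter T π e hkill hker hπ he j v D' x ∈ F (j + D') v := by
  obtain ⟨D₂, rfl⟩ := Nat.exists_eq_add_of_le hDD'
  have h1 := incLocIter_mem_of_mem T π e hkill hker hπ he F hred hsmul (j + D) v hx D₂
  exact (mem_iff_of_heq T F v (by omega) (incLocIter_add_heq T π e hkill hker hπ he j v D D₂ x)).1 h1

end One

/-! ## §2 The local transition maps along a cofinal embedding -/

section Cofinal

variable {N' : ℕ → Type} [∀ k, AddCommGroup (N' k)] [∀ k, TopologicalSpace (N' k)] [∀ k, DiscreteTopology (N' k)]
  [∀ k, Module R (N' k)]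
  (T : AdicTower K R N) (T' : AdicTower K R N') (π π' : R) (e e' : ℕ → ℕ)
  (hkill : ∀ k, ∀ r ∈ IsLocalRing.maximalIdeal R ^ e k, ∀ x : N k, r • x = 0)
  (hker : ∀ k, LinearMap.ker (T.red k) = (IsLocalRing.maximalIdeal R ^ e k) • (⊤ : Submodule R (N (k + 1))))
  (hπ : π ∈ IsLocalRing.maximalIdeal R) (he : ∀ k, e k ≤ e (k + 1))
  (hkill' : ∀ k, ∀ r ∈ IsLocalRing.maximalIdeal R ^ e' k, ∀ x : N' k, r • x = 0)
  (hker' : ∀ k, LinearMap.ker (T'.red k) = (IsLocalRing.maximalIdeal R ^ e' k) • (⊤ : Submodule R (N' (k + 1))))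
  (hπ' : π' ∈ IsLocalRing.maximalIdeal R) (he' : ∀ k, e' k ≤ e' (k + 1))
  (s₀ : ℕ) (d : ℕ → ℕ) {I : ℕ → Ideal R}
  {ι : ∀ k, N k →ₗ[R] N' (idxSeq s₀ d k)}
  (hιq : ∀ k, IsQuotientBy (T.ρ k) (I k) (T'.ρ (idxSeq s₀ d k)) (ι k))

/-- **Local transition compatibility (one step)**: `H¹(K_v, ι_{k+1}) ∘ H¹(K_v, inc_k) = inc'_{σ k → σ(k+1)} ∘ H¹(K_v, ι_k)`
(`inc'` iterated `d k` times). [cite: Howard2004HeegnerKolyvagin, §1.6 (arXiv p. 11 L18–20, p. 12 L40–48)] -/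
theorem cofinal_localCohomologyMap_incLoc (hππ : π' = π) (heσ : ∀ k, e' (idxSeq s₀ d k) = e k)
    (hιred : ∀ k (y : N (k + 1)), ι k (T.red k y) = T'.redIter (idxSeq s₀ d k) (d k) (ι (k + 1) y))
    (k : ℕ) (v : Place K) (c : galoisCohomology ((T.ρ k).toLocal v) 1) :
    (hιq (k + 1)).localCohomologyMap v 1 (incLoc T π e hkill hker hπ he k v c) =
      incLocIter T' π' e' hkill' hker' hπ' he' (idxSeq s₀ d k) v (d k) ((hιq k).localCohomologyMap v 1 c) := by
  subst hππ
  obtain ⟨φ, hφ, hφred, -, hφloc⟩ := exists_linearMap_incH1LE_eq T' π' e' hkill' hker' hπ' he' (idxSeq s₀ d k) (d k)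
  refine Eq.trans ?_ (hφloc v _).symm
  symm
  refine cohomologyMap_one_comm_sq ((T.ρ k).toLocal v) ((T'.ρ (idxSeq s₀ d k)).toLocal v)
    ((T.ρ (k + 1)).toLocal v) ((T'.ρ (idxSeq s₀ d (k + 1))).toLocal v)
    (ι k).toAddMonoidHom (fun _ x => (hιq k).equivariant _ x) φ.toAddMonoidHom (fun _ x => hφ _ x)
    (inc T π' e hkill hker hπ' he k).toAddMonoidHom (fun _ x => inc_equivariant T π' e hkill hker hπ' he k _ x)
    (ι (k + 1)).toAddMonoidHom (fun _ x => (hιq (k + 1)).equivariant _ x) (fun x => ?_) c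
  obtain ⟨y, rfl⟩ := T.red_surjective k x
  change φ (ι k (T.red k y)) = ι (k + 1) (inc T π' e hkill hker hπ' he k (T.red k y))
  rw [hιred, hφred, inc_red, LinearMap.map_smul, heσ]
  change π' ^ (e' (idxSeq s₀ d (k + 1)) - e k) • ι (k + 1) y = _
  rw [heσ]

/-- **Local transition compatibility (all steps, heterogeneous form)**: `H¹(K_v, ι_{k+m}) (inc^m x) ≍ inc'^{D} (H¹(K_v, ι_k) x)`
with `σ k + D = σ (k+m)`. [cite: Howard2004HeegnerKolyvagin, §1.6 (arXiv p. 11 L18–20, p. 12 L40–48)] -/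
theorem cofinal_localCohomologyMap_incLocIter_heq (hππ : π' = π) (heσ : ∀ k, e' (idxSeq s₀ d k) = e k)
    (hιred : ∀ k (y : N (k + 1)), ι k (T.red k y) = T'.redIter (idxSeq s₀ d k) (d k) (ι (k + 1) y))
    (k : ℕ) (v : Place K) (x : galoisCohomology ((T.ρ k).toLocal v) 1) :
    ∀ m : ℕ, ∃ D : ℕ, idxSeq s₀ d k + D = idxSeq s₀ d (k + m) ∧
      HEq ((hιq (k + m)).localCohomologyMap v 1 (incLocIter T π e hkill hker hπ he k v m x))
        (incLocIter T' π' e' hkill' hker' hπ' he' (idxSeq s₀ d k) v D ((hιq k).localCohomologyMap v 1 x))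
  | 0 => ⟨0, rfl, HEq.rfl⟩
  | m + 1 => by
    obtain ⟨D, hD, hheq⟩ := cofinal_localCohomologyMap_incLocIter_heq hππ heσ hιred k v x m
    refine ⟨D + d (k + m), by rw [← Nat.add_assoc, hD]; rfl, ?_⟩
    have h1 : (hιq (k + m + 1)).localCohomologyMap v 1 (incLocIter T π e hkill hker hπ he k v (m + 1) x) =
        incLocIter T' π' e' hkill' hker' hπ' he' (idxSeq s₀ d (k + m)) v (d (k + m))
          ((hιq (k + m)).localCohomologyMap v 1 (incLocIter T π e hkill hker hπ he k v m x)) :=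
      cofinal_localCohomologyMap_incLoc T T' π π' e e' hkill hker hπ he hkill' hker' hπ' he' s₀ d hιq hππ heσ
        hιred (k + m) v _
    refine HEq.trans (heq_of_eq h1) ?_
    exact HEq.trans (heq_incLocIter T' π' e' hkill' hker' hπ' he' v (d (k + m)) hD.symm hheq)
      (incLocIter_add_heq T' π' e' hkill' hker' hπ' he' (idxSeq s₀ d k) v D (d (k + m)) _)

/-- **condA-compatibility at the marked levels** (the propagated condition `condA F' (σ k)` IS `condA F k` propagated
along `ι_k`), from the compatibility of the level conditions at the marked levels (`hιF`), `cond_red`/`cond_smul` on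
both towers, the reduction/transition compatibilities of the embedding and cofinality — no cartesian hypothesis (H.3).
[cite: Howard2004HeegnerKolyvagin, Def. 1.1.3 and §1.6 (arXiv p. 5 L93–99, p. 11 L18–20, p. 12 L29–48)] -/
theorem propagateStructure_condA_eq_of_cofinal (hππ : π' = π) (heσ : ∀ k, e' (idxSeq s₀ d k) = e k)
    (hιk : ∀ k, LinearMap.ker (ι k) = ⊥)
    (hιred : ∀ k (y : N (k + 1)), ι k (T.red k y) = T'.redIter (idxSeq s₀ d k) (d k) (ι (k + 1) y))
    (hcof : ∀ j, ∃ m, j ≤ idxSeq s₀ d m)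
    (F : ∀ k, SelmerStructure (T.ρ k)) (F' : ∀ k, SelmerStructure (T'.ρ k))
    (hred : ∀ (k : ℕ) (v : Place K), ((F (k + 1)) v).map
      (ContinuousRep.cohomologyMap ((T.ρ (k + 1)).toLocal v) ((T.ρ k).toLocal v)
        (T.red k).toAddMonoidHom continuous_of_discreteTopology
        (fun _ x => T.red_equivariant k _ x) 1) = F k v)
    (hsmul : ∀ (k : ℕ) (v : Place K) (r : R), (F k v).map
      (scalarMapH1 ((T.ρ k).toLocal v) ((T.hlin k).restrictField _) r) ≤ F k v)
    (hred' : ∀ (k : ℕ) (v : Place K), ((F' (k + 1)) v).map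
      (ContinuousRep.cohomologyMap ((T'.ρ (k + 1)).toLocal v) ((T'.ρ k).toLocal v)
        (T'.red k).toAddMonoidHom continuous_of_discreteTopology
        (fun _ x => T'.red_equivariant k _ x) 1) = F' k v)
    (hsmul' : ∀ (k : ℕ) (v : Place K) (r : R), (F' k v).map
      (scalarMapH1 ((T'.ρ k).toLocal v) ((T'.hlin k).restrictField _) r) ≤ F' k v)
    (hιF : ∀ k, (hιq k).propagateStructure (F k) = F' (idxSeq s₀ d k)) (k : ℕ) :
    (hιq k).propagateStructure (condA T π e hkill hker hπ he F k) =
      condA T' π' e' hkill' hker' hπ' he' F' (idxSeq s₀ d k) := by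
  funext v
  rw [IsQuotientBy.propagateStructure_apply]
  -- membership at the marked levels, read through `hιF`
  have hmem : ∀ (j : ℕ) (y : galoisCohomology ((T.ρ j).toLocal v) 1),
      y ∈ F j v ↔ (hιq j).localCohomologyMap v 1 y ∈ F' (idxSeq s₀ d j) v := by
    intro j y
    rw [← hιF j, IsQuotientBy.propagateStructure_apply]
    constructor
    · exact fun hy => ⟨y, hy, rfl⟩
    · rintro ⟨y', hy', hyy'⟩
      rwa [← ((hιq j).bijective_localCohomologyMap_of_ker_eq_bot (hιk j) v).1 hyy']
  ext z
  constructor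
  · rintro ⟨x, hx, rfl⟩
    obtain ⟨m, hm⟩ := (mem_condA_iff T π e hkill hker hπ he F hred hsmul k v x).1 hx
    have h1 := (hmem (k + m) _).1 hm
    obtain ⟨D, hD, hheq⟩ := cofinal_localCohomologyMap_incLocIter_heq T T' π π' e e' hkill hker hπ he hkill'
      hker' hπ' he' s₀ d hιq hππ heσ hιred k v x m
    have h2 := (mem_iff_of_heq T' F' v hD.symm hheq).1 h1
    exact (mem_condA_iff T' π' e' hkill' hker' hπ' he' F' hred' hsmul' _ v _).2 ⟨D, h2⟩
  · intro hz
    obtain ⟨x, rfl⟩ := ((hιq k).bijective_localCohomologyMap_of_ker_eq_bot (hιk k) v).2 z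
    refine ⟨x, ?_, rfl⟩
    obtain ⟨D₀, hD₀⟩ := (mem_condA_iff T' π' e' hkill' hker' hπ' he' F' hred' hsmul' _ v _).1 hz
    obtain ⟨m₀, hm₀⟩ := hcof (idxSeq s₀ d k + D₀)
    obtain ⟨D, hD, hheq⟩ := cofinal_localCohomologyMap_incLocIter_heq T T' π π' e e' hkill hker hπ he hkill'
      hker' hπ' he' s₀ d hιq hππ heσ hιred k v x m₀
    have hD₀D : D₀ ≤ D := by
      have h := idxSeq_monotone s₀ d (Nat.le_add_left m₀ k)
      omega
    have h3 := incLocIter_mem_of_incLocIter_mem T' π' e' hkill' hker' hπ' he' F' hred' hsmul' (idxSeq s₀ d k) v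
      _ hD₀D hD₀
    have h4 := (mem_iff_of_heq T' F' v hD hheq.symm).1 h3
    exact (mem_condA_iff T π e hkill hker hπ he F hred hsmul k v x).2 ⟨m₀, (hmem _ _).2 h4⟩


/-- **(C2) with the embedding letters only**: `Ψ : H¹(K, A) ≃+ H¹(K, A')` with `Ψ [c]_k = [H¹(ι_k) c]_{σ k}` carrying
`H¹_F(K, A)` ONTO `H¹_{F'}(K, A')`, for level conditions that agree at the marked levels along `ι_k` (`hιF`) and satisfy
`cond_red`/`cond_smul` on both towers — no cartesian hypothesis.
[cite: Howard2004HeegnerKolyvagin, §1.6 / Thm. 1.6.1 (arXiv p. 11 L18–28, p. 12 L29–48)] -/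
theorem exists_addEquiv_H1A_map_selmerA_eq_of_cofinal (hππ : π' = π) (heσ : ∀ k, e' (idxSeq s₀ d k) = e k)
    (hιk : ∀ k, LinearMap.ker (ι k) = ⊥)
    (hιred : ∀ k (y : N (k + 1)), ι k (T.red k y) = T'.redIter (idxSeq s₀ d k) (d k) (ι (k + 1) y))
    (hcof : ∀ j, ∃ m, j ≤ idxSeq s₀ d m)
    (F : ∀ k, SelmerStructure (T.ρ k)) (F' : ∀ k, SelmerStructure (T'.ρ k))
    (hred : ∀ (k : ℕ) (v : Place K), ((F (k + 1)) v).map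
      (ContinuousRep.cohomologyMap ((T.ρ (k + 1)).toLocal v) ((T.ρ k).toLocal v)
        (T.red k).toAddMonoidHom continuous_of_discreteTopology
        (fun _ x => T.red_equivariant k _ x) 1) = F k v)
    (hsmul : ∀ (k : ℕ) (v : Place K) (r : R), (F k v).map
      (scalarMapH1 ((T.ρ k).toLocal v) ((T.hlin k).restrictField _) r) ≤ F k v)
    (hred' : ∀ (k : ℕ) (v : Place K), ((F' (k + 1)) v).map
      (ContinuousRep.cohomologyMap ((T'.ρ (k + 1)).toLocal v) ((T'.ρ k).toLocal v)
        (T'.red k).toAddMonoidHom continuous_of_discreteTopology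
        (fun _ x => T'.red_equivariant k _ x) 1) = F' k v)
    (hsmul' : ∀ (k : ℕ) (v : Place K) (r : R), (F' k v).map
      (scalarMapH1 ((T'.ρ k).toLocal v) ((T'.hlin k).restrictField _) r) ≤ F' k v)
    (hιF : ∀ k, (hιq k).propagateStructure (F k) = F' (idxSeq s₀ d k)) :
    ∃ Ψ : H1A T π e hkill hker hπ he ≃+ H1A T' π' e' hkill' hker' hπ' he',
      (∀ (k : ℕ) (c : galoisCohomology (T.ρ k) 1),
        Ψ (AddCommGroup.DirectLimit.of (fun k => galoisCohomology (T.ρ k) 1) (incH1LE T π e hkill hker hπ he) k c) =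
          AddCommGroup.DirectLimit.of (fun j => galoisCohomology (T'.ρ j) 1) (incH1LE T' π' e' hkill' hker' hπ' he')
            (idxSeq s₀ d k) ((hιq k).cohomologyMap 1 c)) ∧
      (selmerA T π e hkill hker hπ he F).map (Ψ : H1A T π e hkill hker hπ he →+ H1A T' π' e' hkill' hker' hπ' he') =
        selmerA T' π' e' hkill' hker' hπ' he' F' := by
  obtain ⟨Ψ, hΨ⟩ := exists_addEquiv_H1A_of_cofinal T T' π π' e e' hkill hker hπ he hkill' hker' hπ' he' s₀ d hιq
    hππ heσ hιk hιred hcof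
  have hιA := propagateStructure_condA_eq_of_cofinal T T' π π' e e' hkill hker hπ he hkill' hker' hπ' he' s₀ d hιq
    hππ heσ hιk hιred hcof F F' hred hsmul hred' hsmul' hιF
  have hΨ' : ∀ (k : ℕ) (c : galoisCohomology (T.ρ k) 1),
      (Ψ : H1A T π e hkill hker hπ he →+ H1A T' π' e' hkill' hker' hπ' he')
        (AddCommGroup.DirectLimit.of (fun k => galoisCohomology (T.ρ k) 1) (incH1LE T π e hkill hker hπ he) k c) =
        AddCommGroup.DirectLimit.of (fun j => galoisCohomology (T'.ρ j) 1) (incH1LE T' π' e' hkill' hker' hπ' he')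
          (idxSeq s₀ d k) ((hιq k).cohomologyMap 1 c) := fun k c => hΨ k c
  refine ⟨Ψ, hΨ, le_antisymm (map_selmerA_le_of_cofinal T T' π π' e e' hkill hker hπ he hkill' hker' hπ' he' s₀ d
    hιq hιk F F' hred hsmul hred' hsmul' hιA _ hΨ') fun b hb => ?_⟩
  obtain ⟨a, ha, hab⟩ := exists_mem_selmerA_map_eq_of_cofinal T T' π π' e e' hkill hker hπ he hkill' hker' hπ' he'
    s₀ d hιq hιk hcof F F' hred' hsmul' hιA _ hΨ' hb
  exact ⟨a, ha, hab⟩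

end Cofinal

end AdicTower

end Literature.NumberTheory.GaloisCohomology.Howard2004

end
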